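import Summits.KontsevichZagierPeriods.Zeta5Search.RVCasoratianNormalForm
import HarnessLib

/-!
# fam-rv 14.1 — `RVPivotLaws`: the Plücker relation of the three partner-free minors and the PIVOT SPLIT of the
two-long-class law on zone C

HONEST FRAMING: systematic search; no irrationality claim unless certified.  This file is `p`-adic bookkeeping of
RATIONAL numbers (valuations of `2 × 2` minors of Taylor data of the Brown–Zudilin rational functions `R_b`); it proves
no irrationality statement, no linear-independence statement, and moves no record of the cell
(γ = 0.85488 proved / 0.86597135 conditional on BZ (28); Δγ of this file = 0 — structural).

## Setting (file 13.1 `RVCasoratianNormalForm`)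
On zone C every quantity of the flat-`S₇`-gauge line is a function of `b` alone: the three functionals of `R_b`
— `U = Σ_q c_{4,q}` (`coeffU`, top order), `W = Σ_q c_{2,q}` (`coeffW`), `V = Σ_{o,q} c_{o,q} H_q^{(o+1)}` (`coeffV`) —,
the same three of `y(y+b₀)·R_b` (`coreU`, `coreW`, `coreV`), and the three minors of the `2 × 3` matrix they form:
`casCore = W^c V − W V^c` (the Casoratian), `minorQCore = U W^c − U^c W`, `minorPhatCore = U V^c − U^c V`.
The open node of the line is `TwoLongClassCoreLaw` (13.1; ⟺ gen 11's `TwoLongClassLaw`, which gives `FlatGaugeLawZoneC`):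
`v_p(casCore b) ≥ node(b,p) := refund − N_p + zcBonus` on zone C.

## Content
1. EXACT ALGEBRA (PROVED): the PLÜCKER RELATION `U · Cas = V · Q − W · P̂` (`coeffU_mul_casCore`); the DEFLATION
   identities — for every `r : ℚ`, `Cas = (W^c − rW)·V − W·(V^c − rV)` (`casCore_deflate`), and for `U ≠ 0` with the TOP
   EIGENVALUE `r_U := U^c / U`:  `Q = U·(W^c − r_U W)`, `P̂ = U·(V^c − r_U V)` (`minorQCore_eq_deflated`,
   `minorPhatCore_eq_deflated`): killing the top functional with the quadratic multiplier `y(y+b₀) − r_U` turns the two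
   `U`-minors into single DEFLATED functionals.
   DICTIONARY (formal, coefficient algebra only — nothing about the values): with the cell's decomposition
   `F = U·ζ(5) + W·ζ(3) − V` (`WedgeDictionary`) and `F^c := U^c·ζ(5) + W^c·ζ(3) − V^c`, the two ELIMINANTS of the pair
   are `W^c·F − W·F^c = Q·ζ(5) − Cas` and `U^c·F − U·F^c = P̂ − Q·ζ(3)`: the Casoratian and `Q` are the constant term and
   the `ζ(5)`-coefficient of the `ζ(3)`-free combination, `P̂` is the constant term of the `ζ(5)`-free one.  So (R1) is a
   denominator law for a constant term, while the pivot law (PQ) below concerns a COEFFICIENT (`Q` is harmonic-free: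
   orders 4 and 2 of the partial-fraction data only) and (PP̂) the constant term of the other eliminant.
2. VALUATION GLUE (PROVED, junk-safe): `casCore_val_of_pivot` — if `U ≠ 0` and `v_p(V·Q) ≥ n + v_p(U)`, `v_p(W·P̂) ≥ n + v_p(U)`
   (each only where the product is non-zero) then `v_p(Cas) ≥ n` (ultrametric inequality through the Plücker relation);
   `pivotQ_iff_eigen` / `pivotPhat_iff_eigen`: in eigenvalue form the two hypotheses at `n = node` read
   `v_p(r_W − r_U) ≥ needed` and `v_p(r_V − r_U) ≥ needed`, `needed := node − v_p(W) − v_p(V)`, `r_Φ := Φ^c/Φ` — the three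
   eigenvalues of the multiplier `y(y+b₀)` on `U, W, V` agree to the depth the Casoratian needs.
3. TYPED NODES (OBSERVED — exact census below; NOT proved; minted by this cell, not a published result): on the PIVOT
   REGIME of zone C (`zcBonus ≥ 1`, `U ≠ 0`, `v_p(U) ≤ 0`) the two PIVOT LAWS
   (PQ) `ZoneCPivotLawQ`: `v_p(V · Q) ≥ node + v_p(U)`   and   (PP̂) `ZoneCPivotLawPhat`: `v_p(W · P̂) ≥ node + v_p(U)`;
   each compares ONE lower functional with the explicit top functional (13.1/gen 13: `r_U ∈ ℚ(p)` along every affine family).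
   OFF the regime the law is filed unchanged as `TwoLongOffPivotLaw`; its part `zcBonus = 0` is the existing node (CV)
   (`CasoratianValuation.CasoratianValuationLaw`) and its part `zcBonus ≥ 1 ∧ (U = 0 ∨ p ∣ U)` is `TwoLongShallowULaw`
   (`twoLongOffPivotLaw_of_CV_shallowU`).
4. ASSEMBLY (PROVED): `twoLongClassCoreLaw_of_pivotLaws : ZoneCPivotLawQ → ZoneCPivotLawPhat → TwoLongOffPivotLaw →
   TwoLongClassCoreLaw` (hence `TwoLongClassLaw`, `FlatGaugeLawZoneC`), WITHOUT the (VΓ) node `ZoneCConstantTermBonus`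
   that the row route (12.3) needs; conversely `TwoLongClassCoreLaw → TwoLongOffPivotLaw` and `→ TwoLongShallowULaw`
   (consistency).  The pivot laws are NOT consequences of `TwoLongClassCoreLaw` (they bound `Q` and `P̂`, not `Cas`).

## Census (exact ℚ arithmetic; script `pub-zeta5-fam-rv/gen14/pivot14.py`, rows `gen14/out/pivot14_p{5,7}_*.json`;
one row per zone-C vector `b` with some admissible partner — by 13.1 the laws do not see the partner)
* `p = 5`: zone C = 941 `b` (2,704 instances `(b, j)`); `Cas, U, W, V ≠ 0` on all; (R1) 0 failures.  PIVOT REGIME (`zcBonus ≥ 1`,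
  `v_p(U) ≤ 0`): 549 `b` — (PQ) ∧ (PP̂): 0 violations, TIGHT (margin `min = 0` on 531; (PQ) attained on 471, (PP̂) on 82), containing 288 of
  the 292 RESIDUAL `b` (those with an admissible partner not closed by the tree certificates `RVClassLawCover.coverGuard`: 848 of the 2,704
  instances).  OFF the regime: 392 `b` = 311 with `zcBonus = 0` (none residual) + 81 shallow-`U` (`v_p(U) ≥ 1`; 4 residual, all with
  `needed ≤ 0` and the TERMWISE bound `casCore_val_termwise` exact).
* `p = 7`: zone C = 6,455 `b` (22,098 instances); `Cas, U, W, V ≠ 0` on all; (R1) 0 failures.  PIVOT REGIME: 3,568 `b` — (PQ) ∧ (PP̂):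
  0 violations, margin 0 on 3,419 ((PQ) attained on 2,965, (PP̂) on 2,324), containing 1,779 of the 1,831 residual `b` (6,342 of 22,098
  instances).  OFF: 2,887 `b` = 2,274 with `zcBonus = 0` (none residual) + 613 shallow-`U` (52 residual, all `needed ≤ 0`, termwise exact).
* `p = 11`, random sample (`pivot14s.py`, seed 14) of 300 of the 68,116 zone-C `b` with `Γ ≥ 1`: regime 244 — 0 violations, margin 0 on 239;
  shallow 56 (11 violations of (PQ) ∧ (PP̂), (R1) true).  [`p = 13` sample: see `gen14/out/pivot14_summary.md`.]
* The Casoratian margin IS the pivot margin: `v(Cas) − node = min(dQ, dP̂)` on 541 / 549 and 3,534 / 3,568 regime `b`.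
* Guards considered and rejected (0 violations but too small, or violated): `v_p(U) < 0` (misses 19 + 156 residual `b`), `needed ≥ 2`
  (misses 53 + 361), `nbig ≥ 4` (72 violations at `p = 7`), `zcBonus ≥ 1` alone (3 + 98 violations), `v_p(U) ≤ 0` alone (35 + 227).

## What (PQ), (PP̂) are NOT
Not laws on all of zone C: off the pivot regime `r_U` is the wrong pivot — 85 of the 392 (`p = 5`) and 619 of the 2,887
(`p = 7`) off-regime `b` violate (PQ) ∧ (PP̂) (all with `needed ∈ {−1,0,1}`: the needed digit is the refund digit `⌊d/p⌋`,
carried by `W` and `V` but not by a `p`-integral top functional), while (R1) holds at every `b`.  Not first-order: the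
thresholds contain the ACTUAL valuations `v_p(U), v_p(V), v_p(W)`; the first-order surrogate `v_p(Q) ≥ v_p(U) + refund`
(which with the (VΓ) floor `v_p(V) ≥ −N_p + zcBonus` would give (PQ)) FAILS — `v_p(Q) − v_p(U) − refund ∈ [−4, 1]` on the regime
at both primes; on the residual `v_p(V)` exceeds its (VΓ) floor by 2–3 and `v_p(W) = v_p(U) − 2` (290 / 292 and 1,818 / 1,831
residual `b`), as in gen 13's one-deep-pair local model (`U = 2Aℓ₁`, `W = 2Ae₃`, `e₃ = ℓ₁p⁻²(1 + O(p²))`).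
-/

noncomputable section

open Finset

namespace Summit.KontsevichZagierPeriods.Zeta5Search.RVFlatGauge

open Summit.KontsevichZagierPeriods.Zeta5Search.WedgeDictionary (coeffU coeffW coeffV)
open Summit.KontsevichZagierPeriods.Zeta5Search.CasoratianValuation (casoratian shift InPolytope pairFloors refund
  CasoratianValuationLaw)
open Summit.KontsevichZagierPeriods.Zeta5Search.BigPrime (polytope_hyps)
open Cap ZoneC

/-! ### 1. Exact algebra: Plücker and deflation -/

/-- **PLÜCKER RELATION** of the three partner-free minors: `U · Cas = V · Q − W · P̂`. -/
theorem coeffU_mul_casCore (b : ℕ → ℤ) :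
    coeffU b * casCore b = coeffV b * minorQCore b - coeffW b * minorPhatCore b := by
  unfold casCore minorQCore minorPhatCore; ring

/-- **DEFLATION of the Casoratian**: for every `r`, `Cas = (W^c − rW)·V − W·(V^c − rV)` — the Casoratian of `R_b` and
`(y(y+b₀) − r)·R_b` equals that of `R_b` and `y(y+b₀)·R_b`. -/
theorem casCore_deflate (b : ℕ → ℤ) (r : ℚ) :
    casCore b = (coreW b - r * coeffW b) * coeffV b - coeffW b * (coreV b - r * coeffV b) := by
  unfold casCore; ring

/-- Deflation of the `Q`-minor: for every `r`, `Q = U·(W^c − rW) − (U^c − rU)·W`. -/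
theorem minorQCore_deflate (b : ℕ → ℤ) (r : ℚ) :
    minorQCore b = coeffU b * (coreW b - r * coeffW b) - (coreU b - r * coeffU b) * coeffW b := by
  unfold minorQCore; ring

/-- Deflation of the `P̂`-minor: for every `r`, `P̂ = U·(V^c − rV) − (U^c − rU)·V`. -/
theorem minorPhatCore_deflate (b : ℕ → ℤ) (r : ℚ) :
    minorPhatCore b = coeffU b * (coreV b - r * coeffV b) - (coreU b - r * coeffU b) * coeffV b := by
  unfold minorPhatCore; ring

/-- The TOP EIGENVALUE `r_U := U^c / U` of the multiplier `y(y+b₀)` on the top functional. -/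
def topEigen (b : ℕ → ℤ) : ℚ := coreU b / coeffU b

/-- With the top eigenvalue the `Q`-minor is ONE deflated functional: `Q = U · (W^c − r_U W)` (`U ≠ 0`). -/
theorem minorQCore_eq_deflated (b : ℕ → ℤ) (hU : coeffU b ≠ 0) :
    minorQCore b = coeffU b * (coreW b - topEigen b * coeffW b) := by
  unfold minorQCore topEigen; field_simp

/-- With the top eigenvalue the `P̂`-minor is ONE deflated functional: `P̂ = U · (V^c − r_U V)` (`U ≠ 0`). -/
theorem minorPhatCore_eq_deflated (b : ℕ → ℤ) (hU : coeffU b ≠ 0) :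
    minorPhatCore b = coeffU b * (coreV b - topEigen b * coeffV b) := by
  unfold minorPhatCore topEigen; field_simp

/-- Eigenvalue form of the `Q`-minor: `Q = U·W·(r_W − r_U)` (`U, W ≠ 0`). -/
theorem minorQCore_eq_eigen (b : ℕ → ℤ) (hU : coeffU b ≠ 0) (hW : coeffW b ≠ 0) :
    minorQCore b = coeffU b * coeffW b * (coreW b / coeffW b - topEigen b) := by
  unfold minorQCore topEigen; field_simp

/-- Eigenvalue form of the `P̂`-minor: `P̂ = U·V·(r_V − r_U)` (`U, V ≠ 0`). -/
theorem minorPhatCore_eq_eigen (b : ℕ → ℤ) (hU : coeffU b ≠ 0) (hV : coeffV b ≠ 0) :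
    minorPhatCore b = coeffU b * coeffV b * (coreV b / coeffV b - topEigen b) := by
  unfold minorPhatCore topEigen; field_simp

/-- Eigenvalue form of the Casoratian: `Cas = W·V·(r_W − r_V)` (`W, V ≠ 0`). -/
theorem casCore_eq_eigen (b : ℕ → ℤ) (hW : coeffW b ≠ 0) (hV : coeffV b ≠ 0) :
    casCore b = coeffW b * coeffV b * (coreW b / coeffW b - coreV b / coeffV b) := by
  unfold casCore; field_simp

/-! ### 2. Valuation glue -/

section Valuation

variable {p : ℕ} [Fact p.Prime]

/-- Junk-safe ultrametric inequality for a difference: lower bounds for `x` and `y` (each only where non-zero) give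
the bound for `x − y ≠ 0`. -/
theorem le_padicValRat_sub {x y : ℚ} {n : ℤ} (hx : x ≠ 0 → n ≤ padicValRat p x)
    (hy : y ≠ 0 → n ≤ padicValRat p y) (hxy : x - y ≠ 0) : n ≤ padicValRat p (x - y) := by
  by_cases hx0 : x = 0
  · subst hx0
    have hy0 : y ≠ 0 := by rintro rfl; exact hxy (by simp)
    rw [zero_sub, padicValRat.neg]; exact hy hy0
  by_cases hy0 : y = 0
  · subst hy0; rw [sub_zero]; exact hx hx0
  rw [sub_eq_add_neg] at hxy ⊢
  calc n ≤ min (padicValRat p x) (padicValRat p (-y)) :=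
        le_min (hx hx0) (by rw [padicValRat.neg]; exact hy hy0)
    _ ≤ padicValRat p (x + -y) := padicValRat.min_le_padicValRat_add hxy

/-- **THE PIVOT GLUE**: if `U ≠ 0` and both `V·Q` and `W·P̂` have valuation `≥ n + v_p(U)` (where non-zero), then
`v_p(Cas) ≥ n` — by the Plücker relation `U·Cas = V·Q − W·P̂`. -/
theorem casCore_val_of_pivot (b : ℕ → ℤ) {n : ℤ} (hU : coeffU b ≠ 0)
    (hQ : coeffV b * minorQCore b ≠ 0 → n + padicValRat p (coeffU b) ≤ padicValRat p (coeffV b * minorQCore b))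
    (hP : coeffW b * minorPhatCore b ≠ 0 → n + padicValRat p (coeffU b) ≤ padicValRat p (coeffW b * minorPhatCore b))
    (hcas : casCore b ≠ 0) : n ≤ padicValRat p (casCore b) := by
  have hne : coeffV b * minorQCore b - coeffW b * minorPhatCore b ≠ 0 := by
    rw [← coeffU_mul_casCore]; exact mul_ne_zero hU hcas
  have key := le_padicValRat_sub hQ hP hne
  rw [← coeffU_mul_casCore, padicValRat.mul hU hcas] at key
  linarith

/-- The TERMWISE glue (no cancellation): if both products `W^c·V` and `W·V^c` have valuation `≥ n` (where non-zero)
then `v_p(Cas) ≥ n`.  (Census: this alone gives the node on a minority of zone C — see `TwoLongShallowULaw`.) -/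
theorem casCore_val_termwise (b : ℕ → ℤ) {n : ℤ}
    (h₁ : coreW b * coeffV b ≠ 0 → n ≤ padicValRat p (coreW b * coeffV b))
    (h₂ : coeffW b * coreV b ≠ 0 → n ≤ padicValRat p (coeffW b * coreV b))
    (hcas : casCore b ≠ 0) : n ≤ padicValRat p (casCore b) := by
  unfold casCore at hcas ⊢; exact le_padicValRat_sub h₁ h₂ hcas

/-- (PQ) in EIGENVALUE FORM: for `U, W, V ≠ 0` and `Q ≠ 0`,
`v_p(V·Q) ≥ n + v_p(U)  ⟺  v_p(r_W − r_U) ≥ n − v_p(W) − v_p(V)`. -/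
theorem pivotQ_iff_eigen (b : ℕ → ℤ) {n : ℤ} (hU : coeffU b ≠ 0) (hW : coeffW b ≠ 0) (hV : coeffV b ≠ 0)
    (hQ : minorQCore b ≠ 0) :
    n + padicValRat p (coeffU b) ≤ padicValRat p (coeffV b * minorQCore b) ↔
      n - padicValRat p (coeffW b) - padicValRat p (coeffV b) ≤ padicValRat p (coreW b / coeffW b - topEigen b) := by
  have hd : coreW b / coeffW b - topEigen b ≠ 0 := by
    intro h; apply hQ; rw [minorQCore_eq_eigen b hU hW, h, mul_zero]
  rw [minorQCore_eq_eigen b hU hW, padicValRat.mul hV (mul_ne_zero (mul_ne_zero hU hW) hd),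
    padicValRat.mul (mul_ne_zero hU hW) hd, padicValRat.mul hU hW]
  constructor <;> intro h <;> linarith

/-- (PP̂) in EIGENVALUE FORM: for `U, W, V ≠ 0` and `P̂ ≠ 0`,
`v_p(W·P̂) ≥ n + v_p(U)  ⟺  v_p(r_V − r_U) ≥ n − v_p(W) − v_p(V)`. -/
theorem pivotPhat_iff_eigen (b : ℕ → ℤ) {n : ℤ} (hU : coeffU b ≠ 0) (hW : coeffW b ≠ 0) (hV : coeffV b ≠ 0)
    (hP : minorPhatCore b ≠ 0) :
    n + padicValRat p (coeffU b) ≤ padicValRat p (coeffW b * minorPhatCore b) ↔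
      n - padicValRat p (coeffW b) - padicValRat p (coeffV b) ≤ padicValRat p (coreV b / coeffV b - topEigen b) := by
  have hd : coreV b / coeffV b - topEigen b ≠ 0 := by
    intro h; apply hP; rw [minorPhatCore_eq_eigen b hU hV, h, mul_zero]
  rw [minorPhatCore_eq_eigen b hU hV, padicValRat.mul hW (mul_ne_zero (mul_ne_zero hU hV) hd),
    padicValRat.mul (mul_ne_zero hU hV) hd, padicValRat.mul hU hV]
  constructor <;> intro h <;> linarith

/-- (R1) in EIGENVALUE FORM: for `W, V ≠ 0` and `Cas ≠ 0`, `v_p(Cas) ≥ n ⟺ v_p(r_W − r_V) ≥ n − v_p(W) − v_p(V)`;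
so (PQ) ∧ (PP̂) ⟹ (R1) is the ultrametric inequality for `r_W − r_V = (r_W − r_U) − (r_V − r_U)`. -/
theorem casCore_iff_eigen (b : ℕ → ℤ) {n : ℤ} (hW : coeffW b ≠ 0) (hV : coeffV b ≠ 0) (hcas : casCore b ≠ 0) :
    n ≤ padicValRat p (casCore b) ↔
      n - padicValRat p (coeffW b) - padicValRat p (coeffV b) ≤ padicValRat p (coreW b / coeffW b - coreV b / coeffV b) := by
  have hd : coreW b / coeffW b - coreV b / coeffV b ≠ 0 := by
    intro h; apply hcas; rw [casCore_eq_eigen b hW hV, h, mul_zero]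
  rw [casCore_eq_eigen b hW hV, padicValRat.mul (mul_ne_zero hW hV) hd, padicValRat.mul hW hV]
  constructor <;> intro h <;> linarith

end Valuation

/-! ### 3. The pivot regime and the typed nodes -/

/-! **THE PIVOT REGIME** of a zone-C instance `(b; p, i₁, i₂)` is: positive flat-gauge bonus `zcBonus ≥ 1`, and a top
functional `U(b)` that is non-zero with `v_p(U) ≤ 0` (no factor `p`) — three hypotheses, inlined in the nodes below (OFF the
regime: `zcBonus = 0 ∨ U = 0 ∨ v_p(U) ≥ 1`).  This is where the top functional is the right pivot (census: 0 violations of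
(PQ) ∧ (PP̂) on the regime; see the module docstring for the failures off it). -/

/-- **(PQ) THE PIVOT LAW OF THE `Q`-MINOR ON ZONE C, OBSERVED** (minted by this cell from an exact census; NOT a published
result, NOT proved): on the pivot regime of zone C, `v_p(V(b) · Q(b)) ≥ refund − N_p + zcBonus + v_p(U(b))`, i.e.
`v_p(r_W − r_U) ≥ needed`: the deflated functional `W[(y(y+b₀) − r_U)R_b] = Q/U` is depressed below `W[R_b]` by `p^{needed}`.
Census: 0 violations on the regime — `p = 5`: 549 `b`, `p = 7`: 3,568 `b` (complete zone C), `p = 11`: 244 sampled `b`. -/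
@[conjecture] def ZoneCPivotLawQ : Prop :=
  ∀ (b : ℕ → ℤ) (p i₁ i₂ : ℕ), InPolytope b → (∃ j, 1 ≤ j ∧ j ≤ 7 ∧ InPolytope (shift b j)) → p.Prime → 5 ≤ p →
    b 0 < 3 * (p : ℤ) → i₁ < 7 → i₂ < 7 → i₁ ≠ i₂ →
    (p : ℤ) ≤ b 0 - 2 * b (i₁ + 1) → (p : ℤ) ≤ b 0 - 2 * b (i₂ + 1) → b (i₁ + 1) ≤ b (i₂ + 1) →
    (∀ k ∈ ((range 7).erase i₁).erase i₂, b 0 - 2 * b (k + 1) < p) →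
    1 ≤ zcBonus b p i₁ i₂ → coeffU b ≠ 0 → padicValRat p (coeffU b) ≤ 0 → casCore b ≠ 0 → coeffV b * minorQCore b ≠ 0 →
    refund b p - pairFloors b p + zcBonus b p i₁ i₂ + padicValRat p (coeffU b) ≤ padicValRat p (coeffV b * minorQCore b)

/-- **(PP̂) THE PIVOT LAW OF THE `P̂`-MINOR ON ZONE C, OBSERVED** (minted by this cell from an exact census; NOT a published
result, NOT proved): on the pivot regime of zone C, `v_p(W(b) · P̂(b)) ≥ refund − N_p + zcBonus + v_p(U(b))`, i.e.
`v_p(r_V − r_U) ≥ needed`: the deflated constant term `V[(y(y+b₀) − r_U)R_b] = P̂/U` is depressed below `V[R_b]` by `p^{needed}`.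
Census: 0 violations on the regime — `p = 5`: 549 `b`, `p = 7`: 3,568 `b` (complete zone C), `p = 11`: 244 sampled `b`. -/
@[conjecture] def ZoneCPivotLawPhat : Prop :=
  ∀ (b : ℕ → ℤ) (p i₁ i₂ : ℕ), InPolytope b → (∃ j, 1 ≤ j ∧ j ≤ 7 ∧ InPolytope (shift b j)) → p.Prime → 5 ≤ p →
    b 0 < 3 * (p : ℤ) → i₁ < 7 → i₂ < 7 → i₁ ≠ i₂ →
    (p : ℤ) ≤ b 0 - 2 * b (i₁ + 1) → (p : ℤ) ≤ b 0 - 2 * b (i₂ + 1) → b (i₁ + 1) ≤ b (i₂ + 1) →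
    (∀ k ∈ ((range 7).erase i₁).erase i₂, b 0 - 2 * b (k + 1) < p) →
    1 ≤ zcBonus b p i₁ i₂ → coeffU b ≠ 0 → padicValRat p (coeffU b) ≤ 0 → casCore b ≠ 0 → coeffW b * minorPhatCore b ≠ 0 →
    refund b p - pairFloors b p + zcBonus b p i₁ i₂ + padicValRat p (coeffU b) ≤ padicValRat p (coeffW b * minorPhatCore b)

/-- **THE TWO-LONG-CLASS LAW OFF THE PIVOT REGIME** (= `TwoLongClassCoreLaw` restricted to the complement of the
pivot regime: `zcBonus = 0`, or `U = 0`, or `p ∣ U`).  OBSERVED; its `zcBonus = 0` part is the existing node (CV) and the rest is `TwoLongShallowULaw`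
(`twoLongOffPivotLaw_of_CV_shallowU`).  Census: `p = 5`: 392 `b` off the regime, 388 of them closed by tree certificates
(`RVClassLawCover.coverGuard` for every admissible partner), the 4 residual ones hold by value (termwise); `p = 7`: 2,887 `b`,
2,835 closed by certificates, 52 residual (termwise). -/
@[conjecture] def TwoLongOffPivotLaw : Prop :=
  ∀ (b : ℕ → ℤ) (p i₁ i₂ : ℕ), InPolytope b → (∃ j, 1 ≤ j ∧ j ≤ 7 ∧ InPolytope (shift b j)) → p.Prime → 5 ≤ p →
    b 0 < 3 * (p : ℤ) → i₁ < 7 → i₂ < 7 → i₁ ≠ i₂ →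
    (p : ℤ) ≤ b 0 - 2 * b (i₁ + 1) → (p : ℤ) ≤ b 0 - 2 * b (i₂ + 1) → b (i₁ + 1) ≤ b (i₂ + 1) →
    (∀ k ∈ ((range 7).erase i₁).erase i₂, b 0 - 2 * b (k + 1) < p) →
    (zcBonus b p i₁ i₂ = 0 ∨ coeffU b = 0 ∨ 1 ≤ padicValRat p (coeffU b)) → casCore b ≠ 0 → refund b p - pairFloors b p + zcBonus b p i₁ i₂ ≤ padicValRat p (casCore b)

/-- **THE TWO-LONG-CLASS LAW AT A SHALLOW TOP FUNCTIONAL** (= `TwoLongClassCoreLaw` restricted to `zcBonus ≥ 1` and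
`U = 0 ∨ v_p(U) ≥ 1`).  OBSERVED (census: `p = 5`: 81 `b`, 77 closed by tree certificates, 4 residual — all with `needed ≤ 0` and the termwise
bound exact; `p = 7`: 613 `b`, 561 closed, 52 residual — same; `U = 0` does not occur on zone C for `p ≤ 7`). -/
@[conjecture] def TwoLongShallowULaw : Prop :=
  ∀ (b : ℕ → ℤ) (p i₁ i₂ : ℕ), InPolytope b → (∃ j, 1 ≤ j ∧ j ≤ 7 ∧ InPolytope (shift b j)) → p.Prime → 5 ≤ p →
    b 0 < 3 * (p : ℤ) → i₁ < 7 → i₂ < 7 → i₁ ≠ i₂ →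
    (p : ℤ) ≤ b 0 - 2 * b (i₁ + 1) → (p : ℤ) ≤ b 0 - 2 * b (i₂ + 1) → b (i₁ + 1) ≤ b (i₂ + 1) →
    (∀ k ∈ ((range 7).erase i₁).erase i₂, b 0 - 2 * b (k + 1) < p) → 1 ≤ zcBonus b p i₁ i₂ →
    (coeffU b = 0 ∨ 1 ≤ padicValRat p (coeffU b)) →
    casCore b ≠ 0 → refund b p - pairFloors b p + zcBonus b p i₁ i₂ ≤ padicValRat p (casCore b)

/-! ### 4. Assembly -/

/-- **THE PIVOT SPLIT OF THE TWO-LONG-CLASS LAW** (PROVED reduction): (PQ), (PP̂) and the off-regime law give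
`TwoLongClassCoreLaw` — on the regime by the Plücker glue `casCore_val_of_pivot` at `n = node`. -/
theorem twoLongClassCoreLaw_of_pivotLaws (hQ : ZoneCPivotLawQ) (hP : ZoneCPivotLawPhat) (hoff : TwoLongOffPivotLaw) :
    TwoLongClassCoreLaw := by
  intro b p i₁ i₂ hb hj hp hp5 hn h1 h2 h12 hl1 hl2 hle hshort hne
  haveI : Fact p.Prime := ⟨hp⟩
  by_cases hU0 : coeffU b = 0
  · exact hoff b p i₁ i₂ hb hj hp hp5 hn h1 h2 h12 hl1 hl2 hle hshort (Or.inr (Or.inl hU0)) hne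
  by_cases hreg : 1 ≤ zcBonus b p i₁ i₂ ∧ padicValRat p (coeffU b) ≤ 0
  · exact casCore_val_of_pivot b hU0
      (hQ b p i₁ i₂ hb hj hp hp5 hn h1 h2 h12 hl1 hl2 hle hshort hreg.1 hU0 hreg.2 hne)
      (hP b p i₁ i₂ hb hj hp hp5 hn h1 h2 h12 hl1 hl2 hle hshort hreg.1 hU0 hreg.2 hne) hne
  · have hoff' : zcBonus b p i₁ i₂ = 0 ∨ coeffU b = 0 ∨ 1 ≤ padicValRat p (coeffU b) := by
      have h0 := zcBonus_nonneg b p i₁ i₂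
      by_cases hb1 : 1 ≤ zcBonus b p i₁ i₂
      · exact Or.inr (Or.inr (by by_contra hlt; exact hreg ⟨hb1, by omega⟩))
      · exact Or.inl (by omega)
    exact hoff b p i₁ i₂ hb hj hp hp5 hn h1 h2 h12 hl1 hl2 hle hshort hoff' hne

/-- Hence (PQ), (PP̂) and the off-regime law give gen 11's `TwoLongClassLaw` and the flat `S₇`-gauge law on zone C —
without the (VΓ) node of the row route. -/
theorem flatGaugeLawZoneC_of_pivotLaws (hQ : ZoneCPivotLawQ) (hP : ZoneCPivotLawPhat) (hoff : TwoLongOffPivotLaw) :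
    TwoLongClassLaw ∧ FlatGaugeLawZoneC :=
  have hT := twoLongClassLaw_of_twoLongClassCoreLaw (twoLongClassCoreLaw_of_pivotLaws hQ hP hoff)
  ⟨hT, flatGaugeLawZoneC_of_twoLongClassLaw hT⟩

/-- **The off-regime law from (CV) and the shallow-`U` law** (PROVED): at `zcBonus = 0` the node is (CV) transported to
the normal form (13.1 `casoratian_eq_casCore`, window `b₀ + 2 < p²` from `b₀ < 3p`); at `zcBonus ≥ 1` off the regime
`U = 0 ∨ v_p(U) ≥ 1`. -/
theorem twoLongOffPivotLaw_of_CV_shallowU (hCV : CasoratianValuationLaw) (hS : TwoLongShallowULaw) :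
    TwoLongOffPivotLaw := by
  intro b p i₁ i₂ hb hj hp hp5 hn h1 h2 h12 hl1 hl2 hle hshort hreg hne
  by_cases hbonus : 1 ≤ zcBonus b p i₁ i₂
  · have hU : coeffU b = 0 ∨ 1 ≤ padicValRat p (coeffU b) := by
      rcases hreg with h0 | hU | hU
      · omega
      · exact Or.inl hU
      · exact Or.inr hU
    exact hS b p i₁ i₂ hb hj hp hp5 hn h1 h2 h12 hl1 hl2 hle hshort hbonus hU hne
  · have h0 : zcBonus b p i₁ i₂ = 0 := le_antisymm (by omega) (zcBonus_nonneg b p i₁ i₂)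
    obtain ⟨j, hj1, hj7, hbj⟩ := hj
    obtain ⟨hbox, -, hs⟩ := polytope_hyps b hb
    rw [← casoratian_eq_casCore b hbox hs hj1 hj7] at hne ⊢
    rw [h0, add_zero]
    exact hCV b j p hb hj1 hj7 hbj hp hp5 (win_of_lt_three_p hp5 hn) hne

/-- So the two-long-class law (and FLAT on zone C) follows from (CV), (PQ), (PP̂) and the shallow-`U` law. -/
theorem twoLongClassCoreLaw_of_CV_pivotLaws (hCV : CasoratianValuationLaw) (hQ : ZoneCPivotLawQ)
    (hP : ZoneCPivotLawPhat) (hS : TwoLongShallowULaw) : TwoLongClassCoreLaw :=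
  twoLongClassCoreLaw_of_pivotLaws hQ hP (twoLongOffPivotLaw_of_CV_shallowU hCV hS)

/-- Consistency: the node contains its off-regime restriction. -/
theorem twoLongOffPivotLaw_of_coreLaw (h : TwoLongClassCoreLaw) : TwoLongOffPivotLaw :=
  fun b p i₁ i₂ hb hj hp hp5 hn h1 h2 h12 hl1 hl2 hle hshort _ hne =>
    h b p i₁ i₂ hb hj hp hp5 hn h1 h2 h12 hl1 hl2 hle hshort hne

/-- Consistency: the node contains its shallow-`U` restriction. -/
theorem twoLongShallowULaw_of_coreLaw (h : TwoLongClassCoreLaw) : TwoLongShallowULaw :=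
  fun b p i₁ i₂ hb hj hp hp5 hn h1 h2 h12 hl1 hl2 hle hshort _ _ hne =>
    h b p i₁ i₂ hb hj hp hp5 hn h1 h2 h12 hl1 hl2 hle hshort hne

end Summit.KontsevichZagierPeriods.Zeta5Search.RVFlatGauge

end
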